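import Summits.Langlands.Langlands.Theorems.ParityBlindBianchiTwoAdicBianchiProModularityLevelResidualLevelChange
import Summits.Langlands.Langlands.Theses.ParityBlindBianchi
import HarnessLib

/-!
# `TwoAdicBianchiProModularityLevel` (crux stmt-Langlands-15110, route `ParityBlindBianchi`) —
# RESIDUAL LEVEL CHANGE in the tower and in the crux's vocabulary (odd index and index two)

Residual form ("`χ mod 𝔭` supported on a piece", `𝔭` prime) of the level-change results, for the
pieces `H^i(X_{K(s)}, k/ϖ^t)` of a tower and a sub-tower `T' ≤ T` (generic vocabulary of
`CompletedCohomology`), and for the crux's literal `2`-power Bianchi towers (`k = ℤ̄₂`, `ϖ = 2`,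
`𝔭 = 𝔪`, Hecke family `(v, i) ↦ (t_{v,i+1})_f` over the good places):

* `supp_of_supp_of_relIndex_not_mem`, `supp_piece_of_subtower`, `crux_residualSupport_of_oddIndex` —
  INDEX PRIME TO `𝔭` (odd, for `𝔪_{ℤ̄₂}`): support persists to the smaller level in the same degree
  (restriction–transfer: `[L:L'] · P = tr ∘ res ∘ P`; the residual companion of
  `IsHeckePoint.of_subtower` of `…OddIndexLevelChange`);
* `exists_supp_piece_of_subtower_two`, `crux_residualSupport_of_indexTwo` (registered sub-goal) —
  INDEX TWO (`2 ∈ (ϖ)`): support on `H^i(X_{K(s)}, k/ϖ)` descends to some `H^{i'}(X_{K'(s)}, k/ϖ)`,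
  `i' ≤ i` (`levelTwo_supp_devissage` of `…ResidualLevelChange`: the long exact sequence of
  `0 → Fun_{K(s)} → Fun_{K'(s)} → Fun_{K(s)} → 0`).

Bearing on stub B (`stub_artinLift`): by `…ResidualSupport`, B's hypothesis puts `𝔪_σ̄` in the support
of one `H^i(X_{U₀ ∩ K((2)^s)}, ℤ̄₂/2)`; by the two steps here that residual occurrence propagates from the
tame level `U₀` to every smaller tame level reached by a chain of odd-index and index-two steps with
the stated compatibilities (for `U₀ ∩ K_λ(λ^m)` at an odd bad place `λ`: `GL₂(𝒪/λ^m) ≥` a Sylow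
`2`-subgroup (odd index), then a composition series of that `2`-group) — so the tame level in a big
`R = 𝕋` statement implying B may be taken as deep at the odd places of `S₀` as the ramification of `σ`
requires, at no cost to the hypothesis.  The adelic verification of the compatibilities (product
structure of the levels, `s₀` supported at `λ`) is not done here.

Sorry-free, definition-free; lead c10 (line `Sketch`, cycle 11).

## References

* K. S. Brown, *Cohomology of Groups*, GTM 87 (1982), III §6 Prop. 6.1, §9 Prop. 9.5, §10 Prop. 10.1
  [Brown1982CohomologyGroups].
-/

noncomputable section

set_option linter.dupNamespace false

namespace Summit.Langlands.Langlands.Theorems.TwoAdicBianchiProModularityLevel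

open CategoryTheory Literature.NumberTheory.Automorphic

universe v

/-! ### Index prime to `𝔭`: one level pair -/

section OddIndex

variable {k : Type} [CommRing k] {Γ 𝒢 : Type} [Group Γ] [Group 𝒢] (ι : Γ →* 𝒢)
  {L L' : Subgroup 𝒢} (M : Type) [AddCommGroup M] [Module k M]
  {J : Type v} (δ : J → 𝒢) (χ : J → k) {𝔭 : Ideal k}

/-- **Index prime to `𝔭`: support persists to the smaller level in the same degree.**  Let
`L' ≤ L` with `[L : L'] ∉ 𝔭` (`𝔭` prime) and suppose the Hecke operators `T_{δ j}` commute with the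
pull-back `res : H^i(X_L, M) → H^i(X_{L'}, M)`.  If `χ mod 𝔭` is supported on `H^i(X_L, M)` then it is
supported on `H^i(X_{L'}, M)`: a `P` killing `H^i(X_{L'}, M)` has `res ∘ P = P ∘ res = 0`, hence
`[L:L'] · P = tr ∘ res ∘ P = 0` on `H^i(X_L, M)`, so `[L:L'] P(χ) ∈ 𝔭`.
[cite: Brown1982CohomologyGroups, III §9 Prop. 9.5 (ii), §10 Prop. 10.1] -/
theorem supp_of_supp_of_relIndex_not_mem (h : L' ≤ L) (h𝔭 : 𝔭.IsPrime)
    (hidx : ((L'.relIndex L : ℕ) : k) ∉ 𝔭) (i : ℕ)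
    (hcomm : ∀ j, (ArithmeticQuotient.cohomologyPullback k ι M h i).hom ∘ₗ
        ArithmeticQuotient.heckeEnd k L (δ j) M ι i =
      ArithmeticQuotient.heckeEnd k L' (δ j) M ι i ∘ₗ
        (ArithmeticQuotient.cohomologyPullback k ι M h i).hom)
    (hs : ∀ P : FreeAlgebra k J,
      FreeAlgebra.lift k (fun j => ArithmeticQuotient.heckeEnd k L (δ j) M ι i) P = 0 →
        FreeAlgebra.lift k χ P ∈ 𝔭) :
    ∀ P : FreeAlgebra k J,
      FreeAlgebra.lift k (fun j => ArithmeticQuotient.heckeEnd k L' (δ j) M ι i) P = 0 →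
        FreeAlgebra.lift k χ P ∈ 𝔭 := by
  intro P hP
  have hkill : FreeAlgebra.lift k (fun j => ArithmeticQuotient.heckeEnd k L (δ j) M ι i)
      (((L'.relIndex L : ℕ) : k) • P) = 0 := by
    rw [map_smul]
    refine LinearMap.ext fun x => ?_
    rw [LinearMap.smul_apply, LinearMap.zero_apply]
    have hres : (ArithmeticQuotient.cohomologyPullback k ι M h i).hom
        (FreeAlgebra.lift k (fun j => ArithmeticQuotient.heckeEnd k L (δ j) M ι i) P x) = 0 := by
      have hc := LinearMap.congr_fun (comp_lift_eq_lift_comp _ _ _ hcomm P) x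
      rw [LinearMap.comp_apply, LinearMap.comp_apply, hP, LinearMap.zero_apply] at hc
      exact hc
    have h1 := ArithmeticQuotient.relIndex_smul_eq_zero_of_cohomologyPullback_eq_zero k L L' M ι h i
      hres
    rwa [Nat.cast_smul_eq_nsmul]
  have hval := hs _ hkill
  rw [map_smul, smul_eq_mul] at hval
  exact (h𝔭.mem_or_mem hval).resolve_left hidx

end OddIndex

/-! ### §8 Residual level change in a tower, and in the crux's vocabulary -/

section TowerLevelChange

variable {k : Type} [CommRing k] {Γ 𝒢 : Type} [Group Γ] [Group 𝒢]
  {ι : Γ →* 𝒢} {T T' : LevelTower 𝒢} {ϖ : k} {J : Type v} {δ : J → 𝒢} {χ : J → k} {𝔭 : Ideal k}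

variable (ι T T' ϖ δ χ) in
/-- **Index prime to `𝔭` (e.g. odd index, `𝔭 = 𝔪_{ℤ̄₂}`): residual support persists to the
sub-tower, piece by piece.**  If `T'` is a sub-tower of `T` whose good double cosets correspond
bijectively, and the index `[K(s) : K'(s)]` is not in the prime `𝔭`, then support of `χ mod 𝔭` on
the piece `(i, s, t)` of `T` gives support on the piece `(i, s, t)` of `T'`.
[cite: Brown1982CohomologyGroups, III §9 Prop. 9.5 (ii), §10 Prop. 10.1] -/
theorem supp_piece_of_subtower (hle : ∀ s, T'.level s ≤ T.level s)
    (hbij : ∀ (s : ℕ) (j : J), Set.BijOn (Subgroup.quotientMapOfLE (hle s))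
      (ArithmeticQuotient.doubleCosetQuot (T'.level s) (δ j))
      (ArithmeticQuotient.doubleCosetQuot (T.level s) (δ j)))
    (hfin : ∀ (s : ℕ) (j : J), (ArithmeticQuotient.doubleCosetQuot (T.level s) (δ j)).Finite)
    (h𝔭 : 𝔭.IsPrime) (i s t : ℕ) (hidx : (((T'.level s).relIndex (T.level s) : ℕ) : k) ∉ 𝔭)
    (hs : ∀ P : FreeAlgebra k J,
      FreeAlgebra.lift k (fun j => towerHeckeFamily k ι T ϖ (δ j) (i, s, t)) P = 0 →
        FreeAlgebra.lift k χ P ∈ 𝔭) :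
    ∀ P : FreeAlgebra k J,
      FreeAlgebra.lift k (fun j => towerHeckeFamily k ι T' ϖ (δ j) (i, s, t)) P = 0 →
        FreeAlgebra.lift k χ P ∈ 𝔭 := by
  refine supp_of_supp_of_relIndex_not_mem ι (modPow k ϖ t) δ χ (hle s) h𝔭 hidx i (fun j => ?_) hs
  have hc := ArithmeticQuotient.heckeOperator_comp_cohomologyPullback k ι (modPow k ϖ t)
    (hle s) (δ j) (hbij s j) (hfin s j) i
  have hc' := congrArg ModuleCat.Hom.hom hc
  rw [ModuleCat.hom_comp, ModuleCat.hom_comp] at hc'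
  exact hc'

/-- In `k/ϖ`-coefficients with `2 ∈ (ϖ)`, `m + m = 0`. [folklore] -/
theorem add_self_eq_zero_modPow_one (h2 : (2 : k) ∈ Ideal.span {ϖ ^ 1}) (m : modPow k ϖ 1) :
    m + m = 0 := by
  induction m using Submodule.Quotient.induction_on with
  | H x =>
    rw [← Submodule.Quotient.mk_add, Submodule.Quotient.mk_eq_zero, ← two_mul]
    exact Ideal.mul_mem_right _ _ h2

variable (ι T T' ϖ δ χ) in
/-- **Index two (`2 ∈ (ϖ)`): residual support on a `k/ϖ`-piece of `T` descends to the sub-tower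
`T'` at the same level, in some degree `≤ i`.**  Levelwise hypotheses: `K'(s) ≤ K(s)` of index two
with a common transversal `{1, s₀}`, `K(s)` normalising `K'(s)`, `s₀` commuting with the Hecke
elements, good double cosets corresponding bijectively (finite).
[cite: Brown1982CohomologyGroups, III §6 Prop. 6.1, §9 Prop. 9.5] -/
theorem exists_supp_piece_of_subtower_two (hle : ∀ s, T'.level s ≤ T.level s) {s₀ : 𝒢}
    (hs₀ : s₀ ≠ 1)
    (hS : ∀ s : ℕ, Set.BijOn (fun x : 𝒢 => (x : 𝒢 ⧸ T'.level s)) {1, s₀}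
      (ArithmeticQuotient.doubleCosetQuot₂ (T.level s) (T'.level s) 1))
    (hN : ∀ s : ℕ, ∀ l ∈ T.level s, ∀ y ∈ T'.level s, l⁻¹ * y * l ∈ T'.level s)
    (hsg : ∀ j, s₀ * δ j = δ j * s₀)
    (hbij : ∀ (s : ℕ) (j : J), Set.BijOn (Subgroup.quotientMapOfLE (hle s))
      (ArithmeticQuotient.doubleCosetQuot (T'.level s) (δ j))
      (ArithmeticQuotient.doubleCosetQuot (T.level s) (δ j)))
    (hfin : ∀ (s : ℕ) (j : J), (ArithmeticQuotient.doubleCosetQuot (T.level s) (δ j)).Finite)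
    (h2 : (2 : k) ∈ Ideal.span {ϖ ^ 1}) (h𝔭 : 𝔭.IsPrime) (i s : ℕ)
    (hs : ∀ P : FreeAlgebra k J,
      FreeAlgebra.lift k (fun j => towerHeckeFamily k ι T ϖ (δ j) (i, s, 1)) P = 0 →
        FreeAlgebra.lift k χ P ∈ 𝔭) :
    ∃ i' ≤ i, ∀ P : FreeAlgebra k J,
      FreeAlgebra.lift k (fun j => towerHeckeFamily k ι T' ϖ (δ j) (i', s, 1)) P = 0 →
        FreeAlgebra.lift k χ P ∈ 𝔭 :=
  exists_supp_of_supp_levelTwo ι (modPow k ϖ 1) δ χ (hle s) hs₀ (hS s) (hN s)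
    (add_self_eq_zero_modPow_one h2) hsg (hbij s) (hfin s) h𝔭 i hs

end TowerLevelChange

section CruxLevelChange

open scoped NumberField
open IsDedekindDomain

/-- **Residual level change at an odd-index step, in the crux's vocabulary.**  For
`Γ = GL₂(K) → 𝒢 = GL₂(𝔸_K^∞)`, towers `T' ≤ T` of `𝒢` (for stub B: `(U ∩ K((2)^s))_s ≤ (U₀ ∩ K((2)^s))_s`,
`U ≤ U₀`), the Hecke family `(v, i) ↦ (t_{v,i+1})_f` over the good places with corresponding finite
double cosets, `k = ℤ̄₂`, `ϖ = 2`, `𝔭 = 𝔪`: if `[K(s) : K'(s)]` is ODD, support of `a mod 𝔪` on the piece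
`(i, s, t)` of `T` gives support on the piece `(i, s, t)` of `T'` (`supp_piece_of_subtower`; odd
integers are units of `ℤ̄₂`). [cite: Brown1982CohomologyGroups, III §9 Prop. 9.5 (ii), §10 Prop. 10.1] -/
theorem crux_residualSupport_of_oddIndex : ∀ (K : Type) [Field K] [NumberField K]
    (T T' : LevelTower (GL (Fin 2) (FiniteAdeleRing (𝓞 K) K))) (hle : ∀ s : ℕ, T'.level s ≤ T.level s)
    (S₀ : Finset ℕ) (ϖ : ∀ v : HeightOneSpectrum (𝓞 K), (v.adicCompletion K)ˣ)
    (a : {v : HeightOneSpectrum (𝓞 K) // ∀ ℓ ∈ S₀, ((ℓ : ℕ) : 𝓞 K) ∉ v.asIdeal} → ℕ →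
      (PadicAlgCl.valued 2).v.valuationSubring),
    (∀ (s : ℕ) (j : {v : HeightOneSpectrum (𝓞 K) // ∀ ℓ ∈ S₀, ((ℓ : ℕ) : 𝓞 K) ∉ v.asIdeal} × Fin 2),
      Set.BijOn (Subgroup.quotientMapOfLE (hle s))
        (ArithmeticQuotient.doubleCosetQuot (T'.level s)
          (GLn.sndHom 2 K (heckeDiagAt 2 K j.1.1 (ϖ j.1.1) (j.2.val + 1))))
        (ArithmeticQuotient.doubleCosetQuot (T.level s)
          (GLn.sndHom 2 K (heckeDiagAt 2 K j.1.1 (ϖ j.1.1) (j.2.val + 1))))) →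
    (∀ (s : ℕ) (j : {v : HeightOneSpectrum (𝓞 K) // ∀ ℓ ∈ S₀, ((ℓ : ℕ) : 𝓞 K) ∉ v.asIdeal} × Fin 2),
      (ArithmeticQuotient.doubleCosetQuot (T.level s)
        (GLn.sndHom 2 K (heckeDiagAt 2 K j.1.1 (ϖ j.1.1) (j.2.val + 1)))).Finite) →
    ∀ i s t : ℕ, Odd ((T'.level s).relIndex (T.level s)) →
    (∀ P : FreeAlgebra ((PadicAlgCl.valued 2).v.valuationSubring)
        ({v : HeightOneSpectrum (𝓞 K) // ∀ ℓ ∈ S₀, ((ℓ : ℕ) : 𝓞 K) ∉ v.asIdeal} × Fin 2),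
      FreeAlgebra.lift ((PadicAlgCl.valued 2).v.valuationSubring)
        (fun j : {v : HeightOneSpectrum (𝓞 K) // ∀ ℓ ∈ S₀, ((ℓ : ℕ) : 𝓞 K) ∉ v.asIdeal} × Fin 2 =>
          towerHeckeFamily ((PadicAlgCl.valued 2).v.valuationSubring)
            (Matrix.GeneralLinearGroup.map (algebraMap K (FiniteAdeleRing (𝓞 K) K)) :
              GL (Fin 2) K →* GL (Fin 2) (FiniteAdeleRing (𝓞 K) K))
            T ((2 : ℕ) : (PadicAlgCl.valued 2).v.valuationSubring)
            (GLn.sndHom 2 K (heckeDiagAt 2 K j.1.1 (ϖ j.1.1) (j.2.val + 1))) (i, s, t)) P = 0 →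
      FreeAlgebra.lift ((PadicAlgCl.valued 2).v.valuationSubring)
        (fun j : {v : HeightOneSpectrum (𝓞 K) // ∀ ℓ ∈ S₀, ((ℓ : ℕ) : 𝓞 K) ∉ v.asIdeal} × Fin 2 =>
          a j.1 (j.2.val + 1)) P ∈
          IsLocalRing.maximalIdeal ((PadicAlgCl.valued 2).v.valuationSubring)) →
    ∀ P : FreeAlgebra ((PadicAlgCl.valued 2).v.valuationSubring)
        ({v : HeightOneSpectrum (𝓞 K) // ∀ ℓ ∈ S₀, ((ℓ : ℕ) : 𝓞 K) ∉ v.asIdeal} × Fin 2),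
      FreeAlgebra.lift ((PadicAlgCl.valued 2).v.valuationSubring)
        (fun j : {v : HeightOneSpectrum (𝓞 K) // ∀ ℓ ∈ S₀, ((ℓ : ℕ) : 𝓞 K) ∉ v.asIdeal} × Fin 2 =>
          towerHeckeFamily ((PadicAlgCl.valued 2).v.valuationSubring)
            (Matrix.GeneralLinearGroup.map (algebraMap K (FiniteAdeleRing (𝓞 K) K)) :
              GL (Fin 2) K →* GL (Fin 2) (FiniteAdeleRing (𝓞 K) K))
            T' ((2 : ℕ) : (PadicAlgCl.valued 2).v.valuationSubring)
            (GLn.sndHom 2 K (heckeDiagAt 2 K j.1.1 (ϖ j.1.1) (j.2.val + 1))) (i, s, t)) P = 0 →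
      FreeAlgebra.lift ((PadicAlgCl.valued 2).v.valuationSubring)
        (fun j : {v : HeightOneSpectrum (𝓞 K) // ∀ ℓ ∈ S₀, ((ℓ : ℕ) : 𝓞 K) ∉ v.asIdeal} × Fin 2 =>
          a j.1 (j.2.val + 1)) P ∈
          IsLocalRing.maximalIdeal ((PadicAlgCl.valued 2).v.valuationSubring) := by
  intro K _ _ T T' hle S₀ ϖ a hbij hfin i s t hodd hs
  refine supp_piece_of_subtower _ T T' _ _ _ hle hbij hfin
    (IsLocalRing.maximalIdeal.isMaximal _).isPrime i s t (fun hmem => ?_) hs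
  exact (IsLocalRing.mem_maximalIdeal _).1 hmem (isUnit_natCast_valuationSubring_two_of_odd hodd)

/-- **Residual level change at an index-two step, in the crux's vocabulary** (registered sub-goal).
Same setting; levelwise `K'(s) ≤ K(s)` of index two with a common transversal `{1, s₀}` (`s₀ ≠ 1`;
for stub B: `s₀ ∈ U₀ ∖ U` supported at one odd bad place), `K(s)` normalising `K'(s)`, `s₀` commuting
with the good Hecke elements: support of `a mod 𝔪` on the piece `H^i(X_{K(s)}, ℤ̄₂/2)` of `T` gives
support on some piece `H^{i'}(X_{K'(s)}, ℤ̄₂/2)`, `i' ≤ i`, of `T'` (`exists_supp_piece_of_subtower_two`).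
Together with the odd-index step this is the propagation of residual occurrence from the tame level
`U₀` of B's hypothesis to any smaller tame level reached by odd-index and index-two steps (e.g. to
`U₀ ∩ K_λ(λ^m)` at an odd place `λ ∈ S₀`: `GL₂(𝒪/λ^m) ≥` a Sylow `2`-subgroup, odd index, then a
composition series of the `2`-group). [cite: Brown1982CohomologyGroups, III §6 Prop. 6.1, §9 Prop. 9.5] -/
theorem crux_residualSupport_of_indexTwo : ∀ (K : Type) [Field K] [NumberField K]
    (T T' : LevelTower (GL (Fin 2) (FiniteAdeleRing (𝓞 K) K))) (hle : ∀ s : ℕ, T'.level s ≤ T.level s)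
    (S₀ : Finset ℕ) (ϖ : ∀ v : HeightOneSpectrum (𝓞 K), (v.adicCompletion K)ˣ)
    (a : {v : HeightOneSpectrum (𝓞 K) // ∀ ℓ ∈ S₀, ((ℓ : ℕ) : 𝓞 K) ∉ v.asIdeal} → ℕ →
      (PadicAlgCl.valued 2).v.valuationSubring)
    (s₀ : GL (Fin 2) (FiniteAdeleRing (𝓞 K) K)), s₀ ≠ 1 →
    (∀ s : ℕ, Set.BijOn (fun x : GL (Fin 2) (FiniteAdeleRing (𝓞 K) K) =>
        (x : GL (Fin 2) (FiniteAdeleRing (𝓞 K) K) ⧸ T'.level s)) {1, s₀}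
      (ArithmeticQuotient.doubleCosetQuot₂ (T.level s) (T'.level s) 1)) →
    (∀ s : ℕ, ∀ l ∈ T.level s, ∀ y ∈ T'.level s, l⁻¹ * y * l ∈ T'.level s) →
    (∀ j : {v : HeightOneSpectrum (𝓞 K) // ∀ ℓ ∈ S₀, ((ℓ : ℕ) : 𝓞 K) ∉ v.asIdeal} × Fin 2,
      s₀ * GLn.sndHom 2 K (heckeDiagAt 2 K j.1.1 (ϖ j.1.1) (j.2.val + 1)) =
        GLn.sndHom 2 K (heckeDiagAt 2 K j.1.1 (ϖ j.1.1) (j.2.val + 1)) * s₀) →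
    (∀ (s : ℕ) (j : {v : HeightOneSpectrum (𝓞 K) // ∀ ℓ ∈ S₀, ((ℓ : ℕ) : 𝓞 K) ∉ v.asIdeal} × Fin 2),
      Set.BijOn (Subgroup.quotientMapOfLE (hle s))
        (ArithmeticQuotient.doubleCosetQuot (T'.level s)
          (GLn.sndHom 2 K (heckeDiagAt 2 K j.1.1 (ϖ j.1.1) (j.2.val + 1))))
        (ArithmeticQuotient.doubleCosetQuot (T.level s)
          (GLn.sndHom 2 K (heckeDiagAt 2 K j.1.1 (ϖ j.1.1) (j.2.val + 1))))) →
    (∀ (s : ℕ) (j : {v : HeightOneSpectrum (𝓞 K) // ∀ ℓ ∈ S₀, ((ℓ : ℕ) : 𝓞 K) ∉ v.asIdeal} × Fin 2),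
      (ArithmeticQuotient.doubleCosetQuot (T.level s)
        (GLn.sndHom 2 K (heckeDiagAt 2 K j.1.1 (ϖ j.1.1) (j.2.val + 1)))).Finite) →
    ∀ i s : ℕ,
    (∀ P : FreeAlgebra ((PadicAlgCl.valued 2).v.valuationSubring)
        ({v : HeightOneSpectrum (𝓞 K) // ∀ ℓ ∈ S₀, ((ℓ : ℕ) : 𝓞 K) ∉ v.asIdeal} × Fin 2),
      FreeAlgebra.lift ((PadicAlgCl.valued 2).v.valuationSubring)
        (fun j : {v : HeightOneSpectrum (𝓞 K) // ∀ ℓ ∈ S₀, ((ℓ : ℕ) : 𝓞 K) ∉ v.asIdeal} × Fin 2 =>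
          towerHeckeFamily ((PadicAlgCl.valued 2).v.valuationSubring)
            (Matrix.GeneralLinearGroup.map (algebraMap K (FiniteAdeleRing (𝓞 K) K)) :
              GL (Fin 2) K →* GL (Fin 2) (FiniteAdeleRing (𝓞 K) K))
            T ((2 : ℕ) : (PadicAlgCl.valued 2).v.valuationSubring)
            (GLn.sndHom 2 K (heckeDiagAt 2 K j.1.1 (ϖ j.1.1) (j.2.val + 1))) (i, s, 1)) P = 0 →
      FreeAlgebra.lift ((PadicAlgCl.valued 2).v.valuationSubring)
        (fun j : {v : HeightOneSpectrum (𝓞 K) // ∀ ℓ ∈ S₀, ((ℓ : ℕ) : 𝓞 K) ∉ v.asIdeal} × Fin 2 =>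
          a j.1 (j.2.val + 1)) P ∈
          IsLocalRing.maximalIdeal ((PadicAlgCl.valued 2).v.valuationSubring)) →
    ∃ i' ≤ i, ∀ P : FreeAlgebra ((PadicAlgCl.valued 2).v.valuationSubring)
        ({v : HeightOneSpectrum (𝓞 K) // ∀ ℓ ∈ S₀, ((ℓ : ℕ) : 𝓞 K) ∉ v.asIdeal} × Fin 2),
      FreeAlgebra.lift ((PadicAlgCl.valued 2).v.valuationSubring)
        (fun j : {v : HeightOneSpectrum (𝓞 K) // ∀ ℓ ∈ S₀, ((ℓ : ℕ) : 𝓞 K) ∉ v.asIdeal} × Fin 2 =>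
          towerHeckeFamily ((PadicAlgCl.valued 2).v.valuationSubring)
            (Matrix.GeneralLinearGroup.map (algebraMap K (FiniteAdeleRing (𝓞 K) K)) :
              GL (Fin 2) K →* GL (Fin 2) (FiniteAdeleRing (𝓞 K) K))
            T' ((2 : ℕ) : (PadicAlgCl.valued 2).v.valuationSubring)
            (GLn.sndHom 2 K (heckeDiagAt 2 K j.1.1 (ϖ j.1.1) (j.2.val + 1))) (i', s, 1)) P = 0 →
      FreeAlgebra.lift ((PadicAlgCl.valued 2).v.valuationSubring)
        (fun j : {v : HeightOneSpectrum (𝓞 K) // ∀ ℓ ∈ S₀, ((ℓ : ℕ) : 𝓞 K) ∉ v.asIdeal} × Fin 2 =>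
          a j.1 (j.2.val + 1)) P ∈
          IsLocalRing.maximalIdeal ((PadicAlgCl.valued 2).v.valuationSubring) := by
  intro K _ _ T T' hle S₀ ϖ a s₀ hs₀ hS hN hsg hbij hfin i s hs
  refine exists_supp_piece_of_subtower_two _ T T' _ _ _ hle hs₀ hS hN hsg hbij hfin ?_
    (IsLocalRing.maximalIdeal.isMaximal _).isPrime i s hs
  rw [pow_one]
  exact Ideal.mem_span_singleton_self _

end CruxLevelChange

end Summit.Langlands.Langlands.Theorems.TwoAdicBianchiProModularityLevel

end
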